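import Summits.QuantumFields.BalabanUV.Beta.GAN24.RespStepBmDecompExact
import Summits.QuantumFields.BalabanUV.Beta.GAN24.RespStepBmDecomp

/-!
# `BalabanUV.Beta.GAN24.RespStepBmDecompPsi` — binder row G-an2-4 / (CONV-C), S-slot road «SREC» on the literal of record (family (E)),
# PART V row V4-c (`SKELETON-SREC` v0.2/v0.3 SR-L4a; RULINGS-16 (R16-3) «SREC-DECOMP», file B of the owner's SPLIT RULING l.18461; part 3 of 3 of this seat): THE DECOMPOSITION OF THE COMPOSITE DRESSED
# LEGS — `T_{m→n} = Π_m ∘ respStep (Lc^m) (Lc^n) + dz ∘ Ψ_{m,n}` WITH `Ψ` DISPLAYED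

NOT IN PRINT; OUR BOOKKEEPING (G-an2-4 formalisation swarm, leaf prover `b2b-balaban-gan24-formalise-leaf-03`, gen 41; the row owner
`b2b-balaban-gan24-p1` gen 13's RULINGS-16 addendum (R16-3), journal `CLAIMS.log` l.18387 — «KERNEL (true in every scenario): V4-c» — claim
l.18445; names PROVISIONAL — the owner may rename / re-cut).  HONEST FRAMING (cell contract, verbatim): «discharging `BetaPertH` makes Bałaban's
UV stability UNCONDITIONAL — a real constructive-QFT result; it is NOT the continuum limit and NOT the Clay problem.»  HONEST DEPENDENCY (verbatim):
«continuum YM on T⁴ ⇐ BetaPertH ∧ nine spine estimates (0/9 proved); BetaPertH ⇐ (D1) ∧ (D4) ∧ CAP+tail; G-an2-4 gates asym, D1 and NE2/3/4.»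

WHAT (the owner's `S-REC-SIZING.md` v2 §v2-2 ∕ journal l.18293 (C2), l.18387 §5).  The cubic sector of the (E) recursion pushes its sources through
the CHAINS of leaf-01's dressed one-step legs `D j := respStepBm ρ Lc (Lc^j) (Lc^(j+1)) = Π^ρ_bm ∘ 𝒬_{Lc^j} ℋ_{Lc^{j+1}}` (leaf-17's `legChain`).
Acting on a summable level-`(m+k+1)` datum `b`, the chain of levels `m, …, m+k` is NOT `Π_m` of an2's undressed composite response
`respStep (Lc^m) (Lc^(m+k+1))` (leaf-12's semigroup): each intermediate `Π_i` subtracts an inter-block pure gauge, which the rest of the chain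
transports down as a BLOCK-CONSTANT pure gauge with the factor `(Lc^{d+1})⁻¹` per level (part 2 `legAct_legChain_dz`).  THIS file displays the sum:
* §5 `Psi ρ Lc m k b x := − Σ_{i<k} ((Lc^{(d+1)(i+1)})⁻¹) · bmGaugeAt ρ (legAct (respStep (Lc^(m+i+1)) (Lc^(m+k+1))) b) Lc (blk (Lc^(i+1)) x)`
  (the owner's `Ψ_{m,n}`, `n = m+k+1`: minus the sum over the intermediate levels `m+i+1` of the block-mean-normalised rooted tree gauges of the
  UNDRESSED responses, read through the block labels, with the per-level factors), `Psi_zero`, `Psi_succ` (the recursion at the source end), and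
  **`legAct_legChain_respStepBm`**: for an in-block root, `[NeZero Lc]`, every `m`, every `k` and every summable datum `b`,
  `legAct (legChain D m k) b = Π^ρ_bm (legAct (respStep (Lc^m) (Lc^(m+k+1))) b) + dz (Psi ρ Lc m k b)`
  — induction on `k` at the SOURCE end: `legChain_succ`, part 1's Fubini `legAct_legComp` and linearity `legAct_sub`, part 2's `legAct_bmW`
  (`Π_bm = id − dz ∘ bmGaugeAt`), `summable_bmGaugeAt` and `legAct_legChain_dz` for the exact part, leaf-12's `legComp_respStep` inside `legAct`
  for the undressed part; NO decay rate, NO restriction on `d`.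
* §6 BRIDGE TO leaf-01's INTERFACE (the owner's SPLIT RULING l.18461 gave §1–§4 to `b2b-balaban-gan24-formalise-leaf-01` as file A = tree
  `GAN24/RespStepBmDecomp` p230002, whose `legAct` has the SAME body as part 1's; name swap per leaf-01-g44's journal l.18783): `legAct_eq_legAct`
  (`RespStepBmDecomp.legAct = RespStepBmDecompLegs.legAct`, `rfl`) and the decomposition in file A's currency `legAct_legChain_respStepBm'`
  (chain written as `legChain (fun j => respStepBm ρ Lc (Lc^j) (Lc^(j+1)))`, by `rfl`-transport).  File A's §4 carries a levelwise `LegDecay`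
  hypothesis on the undressed one-step families; parts 1–2 of this seat (`RespStepBmDecompLegs` ∕ `RespStepBmDecompExact`) carry none
  (translation covariance instead of a decay rate), which is why THIS file imports them for the proof.
* §7 (v1.1, APPEND-ONLY) `legDecay_respStep_of_decays` ∕ `legDecay_respStep_levels`: file A's levelwise hypothesis `hD` from the K-slot's decay
  `Decays K̃_j` (leaf-12's `colH_KStepUnit` + leaf-17's `legDecay_colH`) — the one-liner file A's header cites as «part 2 §7».
* §8 (v1.2, APPEND-ONLY) THE INSTANCES OF RECORD: `legChain_neg` (signs ride through the chain), `legChain_colH_coDressKBmAt_KStepUnit` ∕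
  `legChain_rowM_coDressKBmAt_KStepUnit` (the column ∕ row legs of the co-dressed step resolvents `K̃_j` chain as `respStepBmSeq` ∕ `(−1)^(k+1) •` it —
  leaf-01's `RespStepBm` leg dictionary), **`legAct_legChain_colH_coDressKBmAt`** ∕ **`legAct_legChain_rowM_coDressKBmAt`** (the decomposition for the very
  leg chains of the (E) recursion's read identity `RespStepBm.e3K_coDressKBmAt_KStepUnit` ∘ `Push3Nest.transport_push₃`).
* §9 (v1.3, APPEND-ONLY) `decays_KStepUnit_levels` (levelwise decay of `K̃_j`, UNCONDITIONAL: an4's `decays_KInvStep` + asym1's `decays_unitK`),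
  `legDecay_respStep_levels_holds` (file A's `hD` holds), `legAct_legChain_dz'` (file A's §4 by name, hypothesis-free).
* §10 (v1.4, APPEND-ONLY) `curv_sub_dz`, `curv_axProjBmAt'` (`curv ∘ Π_bm = curv`), **`curv_legAct_legChain_respStepBm`** ∕ `…'` and
  **`curvAdj_curv_legAct_legChain_respStepBm`**: the dressed composite leg has the CURVATURE, hence the Maxwell operator `d*d`, of an2's undressed
  composite response (`curv ∘ dz = 0` applied to §5) — the row owner's CT-3 mechanism v1.1 §(c) «`d*d Tᴱ = d*d Tᴮ` exactly» at the `legAct` level.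
[folklore] throughout; one plumbing `def` (`Psi`); 0 cited facts, 0 `def … : Prop`, 0 sorry.  This is the kernel statement exhibiting the owner's
(C2) («dressed composite legs carry hierarchical face jumps»); it is NOT the estimate SR-L4b (`RespStepBmDecay`, owner-reserved, untabled) and sizes
nothing.  Asserts NO shape of Bałaban's stencils; discharges NOTHING of (hS, hSall) on (E); 0 wall binders; NEVER «G-an2-4 closed»; NOT D1,
NOT BetaPertH, NOT continuum, NOT Clay.
-/

noncomputable section

open Finset
open scoped BigOperators
open Literature.MathematicalPhysics.QuantumFieldTheory
open Literature.MathematicalPhysics.QuantumFieldTheory.Balaban1983to89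
open Literature.MathematicalPhysics.QuantumFieldTheory.Balaban1983to89.Beta
open AffineAveraging (Form0 Form1 Site box toSite unitVec dz)
open AffineReproduction (dz_sub dz_const)
open AveragingContours (blk grad_eq_dz)
open KKTFluctuationEnergy (summable_dz)
open BalabanCompositeJets (respStep)
open Summit.QuantumFields.BalabanUV.Beta.AxialProjectorBlockMean (bmGaugeAt axProjBmAt)
open Summit.QuantumFields.BalabanUV.Beta.GAN24.Push4Iter (LegFam legChain legChain_zero legChain_succ)
open Summit.QuantumFields.BalabanUV.Beta.GAN24.RespStepSemigroup (legComp_respStep)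
open Summit.QuantumFields.BalabanUV.Beta.GAN24.RespStepBm (bmW respStepBm respStepBm_def)
open Summit.QuantumFields.BalabanUV.Beta.GAN24.RespStepBmGaugeStep (exists_abs_respStep_le)
open Summit.QuantumFields.BalabanUV.Beta.GAN24.RespStepBmDecompLegs (legAct LegL1 summable_legAct legAct_sub legAct_legComp
  exists_legL1_respStep)
open Summit.QuantumFields.BalabanUV.Beta.GAN24.RespStepBmDecompExact (legAct_bmW summable_bmGaugeAt respStepBmSeq respStepBmSeq_apply
  exists_legL1_respStepBmSeq exists_abs_legChain_le legAct_legChain_dz)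

namespace Summit.QuantumFields.BalabanUV.Beta.GAN24.RespStepBmDecompPsi

variable {d : ℕ}

/-- [folklore] `dz` is homogeneous. -/
theorem dz_smul (c : ℝ) (f : Form0 (d + 1) ℝ) : dz (c • f) = c • dz f := by
  funext κ x; simp only [dz, Pi.smul_apply, smul_eq_mul]; ring

/-! ## §5 `Ψ` and the decomposition -/

section Literal

variable {Lc : ℕ} [NeZero Lc]

/-- [our object] **THE INTER-BLOCK GAUGE TERM `Ψ_{m, m+k+1}`** of the composite dressed leg acting on the datum `b` (the row owner's display):
`Psi ρ Lc m k b x := − Σ_{i < k} ((Lc^{(d+1)(i+1)})⁻¹) · bmGaugeAt ρ (legAct (respStep (Lc^(m+i+1)) (Lc^(m+k+1))) b) Lc (blk (Lc^(i+1)) x)` — for each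
INTERMEDIATE level `m+i+1` the block-mean-normalised rooted tree gauge of the UNDRESSED composite response `respStep (Lc^(m+i+1)) (Lc^(m+k+1)) b`,
read `i+1` levels down through the block label `blk (Lc^(i+1))` (so BLOCK-CONSTANT on the `Lc^(i+1)`-blocks) with the factor `(Lc^{d+1})^{-(i+1)}`. -/
def Psi (ρ : Fin (d + 1) → ℤ) (Lc : ℕ) [NeZero Lc] (m k : ℕ) (b : Form1 (d + 1) ℝ) : Form0 (d + 1) ℝ :=
  fun x => -∑ i ∈ Finset.range k, ((Lc : ℝ) ^ ((d + 1) * (i + 1)))⁻¹ *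
    bmGaugeAt ρ (legAct (respStep (d := d) (Lc ^ (m + i + 1)) (Lc ^ (m + k + 1))) b) Lc (blk (Lc ^ (i + 1)) x)

/-- [folklore] `Psi`, pointwise. -/
theorem Psi_apply (ρ : Fin (d + 1) → ℤ) (m k : ℕ) (b : Form1 (d + 1) ℝ) (x : Site (d + 1)) :
    Psi ρ Lc m k b x = -∑ i ∈ Finset.range k, ((Lc : ℝ) ^ ((d + 1) * (i + 1)))⁻¹ *
      bmGaugeAt ρ (legAct (respStep (d := d) (Lc ^ (m + i + 1)) (Lc ^ (m + k + 1))) b) Lc (blk (Lc ^ (i + 1)) x) := rfl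

/-- [folklore] No intermediate level, no gauge term: `Psi ρ Lc m 0 b = 0`. -/
theorem Psi_zero (ρ : Fin (d + 1) → ℤ) (m : ℕ) (b : Form1 (d + 1) ℝ) : Psi ρ Lc m 0 b = fun _ => 0 := by
  funext x
  rw [Psi_apply, Finset.sum_range_zero, neg_zero]

/-- [folklore] **THE UNDRESSED RESPONSES COMPOSE INSIDE `legAct`** (leaf-12's semigroup law `legComp_respStep` + part 1's Fubini): for a summable
level-`(n+1)` datum `b`, `legAct (respStep (Lc^j) (Lc^n)) (legAct (respStep (Lc^n) (Lc^(n+1))) b) = legAct (respStep (Lc^j) (Lc^(n+1))) b`. -/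
theorem legAct_respStep_legAct {b : Form1 (d + 1) ℝ} (hb : ∀ μ, Summable (b μ)) (j n : ℕ) :
    legAct (respStep (d := d) (Lc ^ j) (Lc ^ n)) (legAct (respStep (d := d) (Lc ^ n) (Lc ^ (n + 1))) b)
      = legAct (respStep (d := d) (Lc ^ j) (Lc ^ (n + 1))) b := by
  obtain ⟨Cr, Tr, hr⟩ := exists_legL1_respStep (d := d) (M := Lc ^ n) (L := Lc) (N' := Lc ^ (n + 1)) (pow_succ Lc n)
  obtain ⟨Cj, hCj⟩ := exists_abs_respStep_le (N' := Lc ^ n) (d := d) (Lc ^ j)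
  rw [← legAct_legComp hb hr hCj, legComp_respStep (L' := Lc) (pow_succ Lc n)]

/-- [folklore] **THE RECURSION OF `Ψ` AT THE SOURCE END**: with `A := legAct (respStep (Lc^(m+k+1)) (Lc^(m+k+2))) b` (the undressed one-step response
to the datum), `Psi ρ Lc m (k+1) b = Psi ρ Lc m k A − ((Lc^{(d+1)(k+1)})⁻¹) • (bmGaugeAt ρ A Lc ∘ blk (Lc^(k+1)))` (summable `b`; `legAct_respStep_legAct`
identifies every response to `A` with the response to `b` one level up). -/
theorem Psi_succ {rr : Fin (d + 1) → ℕ} (m k : ℕ) {b : Form1 (d + 1) ℝ} (hb : ∀ μ, Summable (b μ)) :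
    Psi (toSite rr) Lc m (k + 1) b
      = Psi (toSite rr) Lc m k (legAct (respStep (d := d) (Lc ^ (m + k + 1)) (Lc ^ (m + k + 1 + 1))) b)
        - (((Lc : ℝ) ^ ((d + 1) * (k + 1)))⁻¹) •
          fun x => bmGaugeAt (toSite rr) (legAct (respStep (d := d) (Lc ^ (m + k + 1)) (Lc ^ (m + k + 1 + 1))) b) Lc (blk (Lc ^ (k + 1)) x) := by
  have semi : ∀ i : ℕ, legAct (respStep (d := d) (Lc ^ (m + i + 1)) (Lc ^ (m + k + 1)))
      (legAct (respStep (d := d) (Lc ^ (m + k + 1)) (Lc ^ (m + k + 1 + 1))) b)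
        = legAct (respStep (d := d) (Lc ^ (m + i + 1)) (Lc ^ (m + k + 1 + 1))) b := fun i => legAct_respStep_legAct hb (m + i + 1) (m + k + 1)
  funext x
  rw [Pi.sub_apply, Psi_apply, Psi_apply, show m + (k + 1) + 1 = m + k + 1 + 1 from rfl]
  simp only [Pi.smul_apply, smul_eq_mul, semi, Finset.sum_range_succ]
  ring

/-- [folklore] **THE DECOMPOSITION OF THE COMPOSITE DRESSED LEGS** (row V4-c; in-block root `ρ = toSite rr`, `[NeZero Lc]`, every `m`, every `k`,
every datum with `∀ μ, Summable (b μ)`; NO decay rate, NO restriction on `d`):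
`legAct (legChain D m k) b = Π^ρ_bm (legAct (respStep (Lc^m) (Lc^(m+k+1))) b) + dz (Psi ρ Lc m k b)`, `D = respStepBmSeq ρ Lc` —
the chain of the dressed one-step legs of levels `m, …, m+k` acting on a level-`(m+k+1)` datum is `Π_m` of an2's UNDRESSED composite response plus
the gradient of the displayed inter-block gauge term.  Induction on `k` at the source end: `legChain D m (k+1) = legComp (legChain D m k) (D (m+k+1))`;
`D (m+k+1)` acts as `Π_{bm}` of the undressed one-step response `A` (part 2 `legAct_bmW`), i.e. `A − dz (bmGaugeAt ρ A Lc)` with a SUMMABLE gauge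
(`summable_bmGaugeAt`); the chain acts on `A` by the induction hypothesis and leaf-12's semigroup (`legAct_respStep_legAct`), and on the exact part
by part 2's `legAct_legChain_dz`; `Psi_succ` collects the new term. -/
theorem legAct_legChain_respStepBm {rr : Fin (d + 1) → ℕ} (hrr : rr ∈ box (d + 1) Lc) (m : ℕ) :
    ∀ (k : ℕ) {b : Form1 (d + 1) ℝ}, (∀ μ, Summable (b μ)) →
      legAct (legChain (respStepBmSeq (d := d) (toSite rr) Lc) m k) b
        = axProjBmAt (toSite rr) Lc (legAct (respStep (d := d) (Lc ^ m) (Lc ^ (m + k + 1))) b) + dz (Psi (toSite rr) Lc m k b)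
  | 0, b, hb => by
    have hLc : 1 ≤ Lc := Nat.one_le_iff_ne_zero.2 (NeZero.ne Lc)
    obtain ⟨Cr, Tr, hr⟩ := exists_legL1_respStep (d := d) (M := Lc ^ m) (L := Lc) (N' := Lc ^ (m + 1)) (pow_succ Lc m)
    rw [legChain_zero, respStepBmSeq_apply, respStepBm_def, legAct_bmW hb hr.1 hLc hrr, Psi_zero, dz_const, add_zero]
  | k + 1, b, hb => by
    have hLc : 1 ≤ Lc := Nat.one_le_iff_ne_zero.2 (NeZero.ne Lc)
    rw [show m + (k + 1) + 1 = m + k + 1 + 1 from rfl]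
    obtain ⟨C₁, T₁, h₁⟩ := exists_legL1_respStepBmSeq (d := d) hrr (m + k + 1)
    obtain ⟨C₂, h₂⟩ := exists_abs_legChain_le (d := d) hrr m k
    obtain ⟨Cr, Tr, hr⟩ := exists_legL1_respStep (d := d) (M := Lc ^ (m + k + 1)) (L := Lc) (N' := Lc ^ (m + k + 1 + 1))
      (pow_succ Lc (m + k + 1))
    -- the undressed one-step response `A` and its (summable) block-mean-normalised gauge `g`
    set A : Form1 (d + 1) ℝ := legAct (respStep (d := d) (Lc ^ (m + k + 1)) (Lc ^ (m + k + 1 + 1))) b with hA_def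
    have hA : ∀ μ, Summable (A μ) := fun μ => summable_legAct hb hr μ
    have hg : Summable (bmGaugeAt (toSite rr) A Lc) := summable_bmGaugeAt hLc hrr hA
    -- one dressed step on `b`: `D (m+k+1)` acts as `Π_bm A = A − dz g`
    have step : legAct (respStepBmSeq (d := d) (toSite rr) Lc (m + k + 1)) b = A - dz (bmGaugeAt (toSite rr) A Lc) := by
      rw [respStepBmSeq_apply, respStepBm_def, legAct_bmW hb hr.1 hLc hrr, axProjBmAt, grad_eq_dz]
    rw [legChain_succ, legAct_legComp hb h₁ h₂, step, legAct_sub hA (fun μ => summable_dz hg μ) h₂,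
      legAct_legChain_respStepBm hrr m k hA, legAct_legChain_dz hrr m k hg, hA_def, legAct_respStep_legAct hb m (m + k + 1),
      Psi_succ m k hb, dz_sub, dz_smul]
    abel

/-! ## §6 Bridge to file A's interface (leaf-01's `GAN24/RespStepBmDecomp`) -/

/-- [folklore] **THE TWO `legAct`s AGREE** (file A's `RespStepBmDecomp.legAct`, leaf-01-g44 p230002, and part 1's `RespStepBmDecompLegs.legAct` have the
same body), by `rfl`. -/
theorem legAct_eq_legAct : @RespStepBmDecomp.legAct d = @RespStepBmDecompLegs.legAct d := rfl

/-- [folklore] **THE DECOMPOSITION IN FILE A's CURRENCY** (`RespStepBmDecomp.legAct`, the chain written over the lambda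
`fun j => respStepBm ρ Lc (Lc^j) (Lc^(j+1))` as in file A's §4): the statement of `legAct_legChain_respStepBm`, transported by `rfl`. -/
theorem legAct_legChain_respStepBm' {rr : Fin (d + 1) → ℕ} (hrr : rr ∈ box (d + 1) Lc) (m k : ℕ) {b : Form1 (d + 1) ℝ}
    (hb : ∀ μ, Summable (b μ)) :
    RespStepBmDecomp.legAct (legChain (fun j => respStepBm (toSite rr) Lc (Lc ^ j) (Lc ^ (j + 1))) m k) b
      = axProjBmAt (toSite rr) Lc (RespStepBmDecomp.legAct (respStep (d := d) (Lc ^ m) (Lc ^ (m + k + 1))) b)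
        + dz (Psi (toSite rr) Lc m k b) :=
  legAct_legChain_respStepBm hrr m k hb

/-! ## §7 (v1.1) File A's levelwise hypothesis from the K-slot's decay -/

/-- [folklore] **FILE A's LEVELWISE HYPOTHESIS FROM THE K-SLOT's DECAY** (the fact file A's header, `GAN24/RespStepBmDecomp` l.40, cites as «part 2 §7»):
`Decays K̃_j C m ⟹ LegDecay (respStep (Lc^j) (Lc^(j+1))) Lc C m` — the one-step response family IS the `ℋ`-column leg of `K̃_j = KStepUnit Lc j`
(leaf-12's `RespStepSemigroup.colH_KStepUnit`), and the `ℋ`-column legs of a decaying kernel are localised (leaf-17's `Push4Bounds.legDecay_colH`). -/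
theorem legDecay_respStep_of_decays {j : ℕ} {C m : ℝ} (hK : ExpKernelCalculus.Decays (CombesThomas.KStepUnit (d := d) Lc j) C m) :
    Push4Bounds.LegDecay (respStep (d := d) (Lc ^ j) (Lc ^ (j + 1))) Lc C m := by
  rw [← RespStepSemigroup.colH_KStepUnit]
  exact Push4Bounds.legDecay_colH hK

/-- [folklore] … hence the levelwise form `hD : ∀ j, ∃ C m, 0 < m ∧ LegDecay (respStep (Lc^j) (Lc^(j+1))) Lc C m` consumed by file A's `legAct_respStep_succ` ∕
`legAct_legChain_dz`, from levelwise K-slot decay (the shape leaf-01's `RespStepBm.legDecay_literal_legs` takes; road P1's K-slot supplies it).  File B's own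
`legAct_legChain_respStepBm` needs NO such input. -/
theorem legDecay_respStep_levels (hK : ∀ j, ∃ C m : ℝ, 0 < m ∧ ExpKernelCalculus.Decays (CombesThomas.KStepUnit (d := d) Lc j) C m) :
    ∀ j, ∃ C m : ℝ, 0 < m ∧ Push4Bounds.LegDecay (respStep (d := d) (Lc ^ j) (Lc ^ (j + 1))) Lc C m := fun j => by
  obtain ⟨C, m, hm, h⟩ := hK j
  exact ⟨C, m, hm, legDecay_respStep_of_decays h⟩

/-! ## §8 (v1.2) The instances of record: the chains of the co-dressed step resolvents' legs -/

/-- [folklore] Scalars on the outer leg come out of the composition. -/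
theorem legComp_smul_left (c : ℝ) (r₂ r₁ : LegFam d) : Push4.legComp (c • r₂) r₁ = c • Push4.legComp r₂ r₁ := by
  funext μ y κ u
  simp only [Push4.legComp_apply, Pi.smul_apply, smul_eq_mul, Finset.mul_sum, ← tsum_mul_left]
  exact tsum_congr fun v => Finset.sum_congr rfl fun lam _ => by ring

/-- [folklore] Scalars on the leg come out of the action. -/
theorem legAct_smul_leg (c : ℝ) (r : LegFam d) (b : Form1 (d + 1) ℝ) : legAct (c • r) b = c • legAct r b := by
  funext κ u
  simp only [RespStepBmDecompLegs.legAct_apply, Pi.smul_apply, smul_eq_mul, Finset.mul_sum, ← tsum_mul_left]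
  exact Finset.sum_congr rfl fun μ _ => tsum_congr fun y => by ring

/-- [folklore] **SIGNS RIDE THROUGH THE CHAIN**: `legChain (−D) m k = (−1)^(k+1) • legChain D m k` (leaf-12's `legComp_neg_right` + `legComp_smul_left`). -/
theorem legChain_neg (D : ℕ → LegFam d) (m : ℕ) : ∀ k, legChain (fun j => -D j) m k = ((-1 : ℝ) ^ (k + 1)) • legChain D m k
  | 0 => by
    rw [legChain_zero, legChain_zero, zero_add, pow_one, neg_one_smul]
  | k + 1 => by
    rw [legChain_succ, legChain_succ, legChain_neg D m k, RespStepSemigroup.legComp_neg_right, legComp_smul_left, ← neg_one_smul ℝ (_ • _),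
      smul_smul]
    congr 1
    ring

/-- [folklore] **THE COLUMN ∕ TABLE LEGS OF THE CO-DRESSED STEP RESOLVENTS CHAIN AS `respStepBmSeq`**: `legChain (fun j ↦ colH (coDressKBmAt ρ Lc K̃_j) Lc) m k
= legChain (respStepBmSeq ρ Lc) m k` (leaf-01's `RespStepBm.colH_coDressKBmAt_KStepUnit`, levelwise). -/
theorem legChain_colH_coDressKBmAt_KStepUnit (ρ : Fin (d + 1) → ℤ) (m k : ℕ) :
    legChain (fun j => OneStepKernelFamily.colH (AxialDressingRooted.coDressKBmAt ρ Lc (CombesThomas.KStepUnit (d := d) Lc j)) Lc) m k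
      = legChain (respStepBmSeq (d := d) ρ Lc) m k := by
  congr 1
  funext j
  exact RespStepBm.colH_coDressKBmAt_KStepUnit ρ j

/-- [folklore] **THE ROW LEGS CHAIN AS `−respStepBmSeq` UP TO THE SIGN `(−1)^(k+1)`**: `legChain (fun j ↦ rowM (coDressKBmAt ρ Lc K̃_j) Lc) m k
= (−1)^(k+1) • legChain (respStepBmSeq ρ Lc) m k` (leaf-01's `rowM_coDressKBmAt_KStepUnit`: `ℋ♭ = −ℋᵀ`, + `legChain_neg`). -/
theorem legChain_rowM_coDressKBmAt_KStepUnit (ρ : Fin (d + 1) → ℤ) (m k : ℕ) :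
    legChain (fun j => Push4.rowM (AxialDressingRooted.coDressKBmAt ρ Lc (CombesThomas.KStepUnit (d := d) Lc j)) Lc) m k
      = ((-1 : ℝ) ^ (k + 1)) • legChain (respStepBmSeq (d := d) ρ Lc) m k := by
  rw [← legChain_neg]
  congr 1
  funext j
  exact RespStepBm.rowM_coDressKBmAt_KStepUnit ρ j

/-- [folklore] **THE DECOMPOSITION FOR THE COLUMN ∕ TABLE LEG CHAINS OF THE (E) RECURSION IN UNITS** (the legs of leaf-01's read identity
`RespStepBm.e3K_coDressKBmAt_KStepUnit`, chained by `Push3Nest.transport_push₃`): for an in-block root, every `m`, `k` and summable datum `b`,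
`legAct (legChain (fun j ↦ colH (coDressKBmAt ρ Lc K̃_j) Lc) m k) b = Π^ρ_bm (legAct (respStep (Lc^m) (Lc^(m+k+1))) b) + dz (Psi ρ Lc m k b)`. -/
theorem legAct_legChain_colH_coDressKBmAt {rr : Fin (d + 1) → ℕ} (hrr : rr ∈ box (d + 1) Lc) (m k : ℕ) {b : Form1 (d + 1) ℝ}
    (hb : ∀ μ, Summable (b μ)) :
    legAct (legChain (fun j => OneStepKernelFamily.colH (AxialDressingRooted.coDressKBmAt (toSite rr) Lc (CombesThomas.KStepUnit (d := d) Lc j)) Lc) m k) b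
      = axProjBmAt (toSite rr) Lc (legAct (respStep (d := d) (Lc ^ m) (Lc ^ (m + k + 1))) b) + dz (Psi (toSite rr) Lc m k b) := by
  rw [legChain_colH_coDressKBmAt_KStepUnit]
  exact legAct_legChain_respStepBm hrr m k hb

/-- [folklore] **… AND FOR THE ROW LEG CHAINS** (sign `(−1)^(k+1)`):
`legAct (legChain (fun j ↦ rowM (coDressKBmAt ρ Lc K̃_j) Lc) m k) b = (−1)^(k+1) • (Π^ρ_bm (legAct (respStep (Lc^m) (Lc^(m+k+1))) b) + dz (Psi ρ Lc m k b))`. -/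
theorem legAct_legChain_rowM_coDressKBmAt {rr : Fin (d + 1) → ℕ} (hrr : rr ∈ box (d + 1) Lc) (m k : ℕ) {b : Form1 (d + 1) ℝ}
    (hb : ∀ μ, Summable (b μ)) :
    legAct (legChain (fun j => Push4.rowM (AxialDressingRooted.coDressKBmAt (toSite rr) Lc (CombesThomas.KStepUnit (d := d) Lc j)) Lc) m k) b
      = ((-1 : ℝ) ^ (k + 1)) •
        (axProjBmAt (toSite rr) Lc (legAct (respStep (d := d) (Lc ^ m) (Lc ^ (m + k + 1))) b) + dz (Psi (toSite rr) Lc m k b)) := by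
  rw [legChain_rowM_coDressKBmAt_KStepUnit, legAct_smul_leg, legAct_legChain_respStepBm hrr m k hb]

/-! ## §9 (v1.3) The levelwise K-slot decay is UNCONDITIONAL — hence so are file A's `hD` and the literal's leg hypotheses -/

/-- [folklore] **LEVELWISE DECAY OF THE UNIT-NORMALISED STEP RESOLVENTS, UNCONDITIONALLY**: `∀ j, ∃ C m, 0 < m ∧ Decays K̃_j C m`
(`K̃_j = KStepUnit Lc j = D_j · KInvStep Lc j · D_j`): an4's `OneStepKernelFamily.decays_KInvStep` (the decimated composite resolvent decays, per
`Lc`, `j`) transported through the leg units by asym1's `HessKerDressedUnits.decays_unitK`.  Per-level constants only (NOT the K-slot's UNIFORM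
decay ∕ rate — that is road P1's business); exactly the qualitative input `legDecay_respStep_levels` (§7), leaf-01's `RespStepBm.legDecay_literal_legs`
and file A's `legAct_legChain_dz` ∕ `legAct_respStep_succ` take — all three are thereby hypothesis-free BY NAME
(`RespStepBmDecomp.legAct_legChain_dz hrr legDecay_respStep_levels_holds m₀ k hψ`, `RespStepBm.legDecay_literal_legs hLc hrr decays_KStepUnit_levels`). -/
theorem decays_KStepUnit_levels : ∀ j, ∃ C m : ℝ, 0 < m ∧ ExpKernelCalculus.Decays (CombesThomas.KStepUnit (d := d) Lc j) C m := fun j => by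
  obtain ⟨δ, C, hδ, -, hK⟩ := OneStepKernelFamily.decays_KInvStep (Lc := Lc) (d := d) j
  exact ⟨_, δ, hδ, HessKerDressedUnits.decays_unitK hK⟩

/-- [folklore] **FILE A's LEVELWISE HYPOTHESIS `hD` HOLDS**: `∀ j, ∃ C m, 0 < m ∧ LegDecay (respStep (Lc^j) (Lc^(j+1))) Lc C m` (§7 + `decays_KStepUnit_levels`). -/
theorem legDecay_respStep_levels_holds :
    ∀ j, ∃ C m : ℝ, 0 < m ∧ Push4Bounds.LegDecay (respStep (d := d) (Lc ^ j) (Lc ^ (j + 1))) Lc C m :=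
  legDecay_respStep_levels decays_KStepUnit_levels

/-- [folklore] **FILE A's §4 UNCONDITIONALLY, BY NAME** (leaf-01's `RespStepBmDecomp.legAct_legChain_dz` with `hD := legDecay_respStep_levels_holds`; the same
statement as part 2's `RespStepBmDecompExact.legAct_legChain_dz` in A's currency). -/
theorem legAct_legChain_dz' {rr : Fin (d + 1) → ℕ} (hrr : rr ∈ box (d + 1) Lc) (m₀ k : ℕ) {ψ : Site (d + 1) → ℝ} (hψ : Summable ψ) :
    RespStepBmDecomp.legAct (legChain (fun j => respStepBm (toSite rr) Lc (Lc ^ j) (Lc ^ (j + 1))) m₀ k) (dz ψ)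
      = (((Lc : ℝ) ^ ((d + 1) * (k + 1)))⁻¹) • dz (fun x => ψ (blk (Lc ^ (k + 1)) x)) :=
  RespStepBmDecomp.legAct_legChain_dz hrr legDecay_respStep_levels_holds m₀ k hψ

/-! ## §10 (v1.4, APPEND-ONLY) The dressed composite legs have the CURVATURE — hence the Maxwell operator `d*d` — of the undressed response
(the row owner's CT-3 mechanism, `HOME/b2b-balaban-gan24-p1/gen18/CT3-MECHANISM.md` v1.1 §(c): «`d*d Tᴱ = d*d Tᴮ` exactly (`curv ∘ dz = 0`)»,
at the `legAct` level of THIS file's decomposition, for CT-3c `ContactAssembly`) -/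

/-- [folklore] `curv` kills the gradient of any gauge: `curv (A − dz g) = curv A` (`AffineAveraging.curv_dz` + linearity). -/
theorem curv_sub_dz (A : Form1 (d + 1) ℝ) (g : Form0 (d + 1) ℝ) : AffineAveraging.curv (A - dz g) = AffineAveraging.curv A := by
  have h0 := AffineAveraging.curv_dz g
  funext κ l x
  have h := congr_fun (congr_fun (congr_fun h0 κ) l) x
  simp only [AffineAveraging.curv, Pi.sub_apply, Pi.zero_apply] at h ⊢
  linarith

/-- [folklore] `curv` kills the block-mean axial dressing: `curv (Π^ρ_bm A) = curv A` (`Π_bm = id − grad ∘ bmGaugeAt`, `grad = dz`; the statement of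
an2's `BorderedHessianBlind.curv_axProjBmAt`, re-proved in two lines to keep this file's import cone). -/
theorem curv_axProjBmAt' (ρ : Fin (d + 1) → ℤ) (N : ℕ) (A : Form1 (d + 1) ℝ) : AffineAveraging.curv (axProjBmAt ρ N A) = AffineAveraging.curv A := by
  rw [axProjBmAt, grad_eq_dz]
  exact curv_sub_dz A _

/-- [folklore] **THE DRESSED COMPOSITE LEG HAS THE CURVATURE OF THE UNDRESSED COMPOSITE RESPONSE**: for an in-block root, every `m k` and every
summable datum `b`, `curv (legAct (legChain (respStepBmSeq ρ Lc) m k) b) = AffineAveraging.curv (legAct (respStep (Lc^m) (Lc^(m+k+1))) b)` — §5's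
`legAct_legChain_respStepBm` (`= Π_bm (undressed) + dz Ψ`) read through `curv ∘ dz = 0` twice (the level-`m` dressing `Π_bm` AND the inter-block
gauge `dz Ψ` are both invisible to `curv`). -/
theorem curv_legAct_legChain_respStepBm {rr : Fin (d + 1) → ℕ} (hrr : rr ∈ box (d + 1) Lc) (m k : ℕ) {b : Form1 (d + 1) ℝ}
    (hb : ∀ μ, Summable (b μ)) :
    AffineAveraging.curv (legAct (legChain (respStepBmSeq (d := d) (toSite rr) Lc) m k) b)
      = AffineAveraging.curv (legAct (respStep (d := d) (Lc ^ m) (Lc ^ (m + k + 1))) b) := by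
  rw [legAct_legChain_respStepBm hrr m k hb]
  have h : axProjBmAt (toSite rr) Lc (legAct (respStep (d := d) (Lc ^ m) (Lc ^ (m + k + 1))) b) + dz (Psi (toSite rr) Lc m k b)
      = axProjBmAt (toSite rr) Lc (legAct (respStep (d := d) (Lc ^ m) (Lc ^ (m + k + 1))) b) - dz (-(Psi (toSite rr) Lc m k b)) := by
    funext κ x
    simp only [Pi.add_apply, Pi.sub_apply, dz, Pi.neg_apply]
    ring
  rw [h, curv_sub_dz, curv_axProjBmAt']

/-- [folklore] **HENCE THE SAME MAXWELL OPERATOR**: `curvAdj (AffineAveraging.curv (legAct (legChain (respStepBmSeq ρ Lc) m k) b)) = AffineAveraging.curvAdj (AffineAveraging.curv (legAct (respStep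
(Lc^m) (Lc^(m+k+1))) b))` — the Euler–Lagrange side `d*d` of a dressed composite leg is that of an2's undressed composite response, so the CT-3
contact cells see dressed partners only through the pure-gauge pairing (CT3-MECHANISM v1.1 §(c)). -/
theorem curvAdj_curv_legAct_legChain_respStepBm {rr : Fin (d + 1) → ℕ} (hrr : rr ∈ box (d + 1) Lc) (m k : ℕ) {b : Form1 (d + 1) ℝ}
    (hb : ∀ μ, Summable (b μ)) :
    AffineAveraging.curvAdj (AffineAveraging.curv (legAct (legChain (respStepBmSeq (d := d) (toSite rr) Lc) m k) b))
      = AffineAveraging.curvAdj (AffineAveraging.curv (legAct (respStep (d := d) (Lc ^ m) (Lc ^ (m + k + 1))) b)) := by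
  rw [curv_legAct_legChain_respStepBm hrr m k hb]

/-- [folklore] The same in file A's currency (`RespStepBmDecomp.legAct`, chain over the lambda `fun j => respStepBm ρ Lc (Lc^j) (Lc^(j+1))`). -/
theorem curv_legAct_legChain_respStepBm' {rr : Fin (d + 1) → ℕ} (hrr : rr ∈ box (d + 1) Lc) (m k : ℕ) {b : Form1 (d + 1) ℝ}
    (hb : ∀ μ, Summable (b μ)) :
    AffineAveraging.curv (RespStepBmDecomp.legAct (legChain (fun j => respStepBm (toSite rr) Lc (Lc ^ j) (Lc ^ (j + 1))) m k) b)
      = AffineAveraging.curv (RespStepBmDecomp.legAct (respStep (d := d) (Lc ^ m) (Lc ^ (m + k + 1))) b) :=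
  curv_legAct_legChain_respStepBm hrr m k hb

end Literal

end Summit.QuantumFields.BalabanUV.Beta.GAN24.RespStepBmDecompPsi

end
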